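/-
Copyright: seat `ym-line-cbag-p2` (prover-ym-line-cbag-p2-g2-0), route `ColdBoxAllGroups`, crux `BulkAllGroups`
(stmt-QuantumFields-22255), line `dlr-chessboard-G` (skeleton `Cruxes/BulkAllGroups/Lines/birth.lean` v5): the registered stub
`stub_kernelCovExpansionG` — PROVED.
-/
import Summits.QuantumFields.YangMills.Theorems.ColdBoxAllGroupsBulkAllGroupsKernelCovDatumAtBetaG
import Summits.QuantumFields.YangMills.Theorems.ColdBoxAllGroupsBulkAllGroupsKernelDatumBoundsG

/-!
# Crux `BulkAllGroups` (stmt-QuantumFields-22255), line `dlr-chessboard-G`, skeleton v5: the registered stub `stub_kernelCovExpansionG` — the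
# one-scale expansion of the deep kernel COVARIANCE, uniformly over crude-good data, for EVERY compact simple gauge group

`stub_kernelCovExpansionG : ∀ G …, IsCompactSimpleLieGroup G → ∀ r : LatticeRep G, ∃ θ₂ > 0, ∀ 0 < θ ≤ θ₂, KernelCovExpansionG r.ρ (θ/20) θ (θ/5)`
with `θ₂ = 1/200` — the `G`-port of the PROVED `SU(2)` stub `stub_kernelCovExpansion`.  Fix `0 < θ ≤ 1/200`, `δ = θ/5`, `A = θ/20`, `ε = 6θ`;
eventually in `β` (`eventually_kernelDatum_boundsG`, p1: link window below the local-surjectivity radius, chart ball `m = 2L ≤ min(1/4, r₂)`, Gaussian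
link radius `mE ≤ m`, sandwich window, Gaussian bad mass `≤ 1/2`, and the core's bound `≤ β^{−θ/2}`), for every crude-good `ω` the datum package
(w3 `exists_datum_packageG_datVec`), the YM rarity at the truncated gauge copy (w2 `boxKernelG_real_coldGoodSetG_compl_le_trunc`), Helgason's Jacobian
(w2 `exists_chartMeasureE_restrict_closedBall_eq_withDensity`) and the link window (`linkWindow_subset_image_expChart`) feed the one-`β` theorem
`kernelCovG_sub_interface_le` (lead p2); the interface's datum is the half-scaled `ϑ⁰ = ϑ/√2` with energy `½·` the package's
(`sum_formM_smul_chartCoords`).  No sorry; no new definition; no named-fact hypothesis; standard axioms.  NOT a claim about the mass gap: a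
finite-volume weak-coupling statement about one Wilson box with a small boundary datum (rung-level support R2xi-G `XiPow`, RECORD label); the
Yang–Mills mass gap is NOT proved by this.
-/

set_option autoImplicit false

noncomputable section

open MeasureTheory ProbabilityTheory Finset Real Filter Topology Metric
open scoped ENNReal Matrix.Norms.Frobenius
open Literature.Probability.LatticeModels (Site glueWith)
open Literature.MathematicalPhysics.QuantumLattice
open Literature.MathematicalPhysics.QuantumFieldTheory
open Literature.MathematicalPhysics.QuantumFieldTheory.LatticeMaxwell
open Literature.MathematicalPhysics.QuantumFieldTheory.AxialGauge
open Summit.QuantumFields.YangMills.Theorems.WeakCouplingRates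
open Summit.QuantumFields.YangMills.Theorems.FreeEnergyLogCoefficient

namespace Summit.QuantumFields.YangMills.Theorems.ColdBoxAllGroups

section Box

variable {N : ℕ} {G : Type} [Group G] [TopologicalSpace G] [IsTopologicalGroup G] [CompactSpace G]
  [MeasurableSpace G] [BorelSpace G] [SecondCountableTopology G]
variable (ρ : G →* Matrix (Fin N) (Fin N) ℂ)

set_option maxHeartbeats 400000 in
/-- **A-cov for small `θ`, every compact group presented in `U(N)` with positive chart dimension**: `KernelCovExpansionG ρ (θ/20) θ (θ/5)` for
every `0 < θ ≤ 1/200` (faithful continuous unitary `ρ`). -/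
theorem kernelCovExpansionG_of_le (hρc : Continuous ρ) (hinj : Function.Injective ρ) (hρu : ∀ g, ρ g ∈ Matrix.unitaryGroup (Fin N) ℂ)
    (hD : 0 < dimE ρ) {θ : ℝ} (hθ : 0 < θ) (hθ2 : θ ≤ 1 / 200) : KernelCovExpansionG ρ (θ / 20) θ (θ / 5) := by
  haveI : NeZero N := neZero_of_dimE_pos ρ hρc hinj hD
  have hδ0 : (0 : ℝ) ≤ θ / 5 := by positivity
  have hwin9 : 9 * θ + θ / 5 < 1 / 2 := by linarith only [hθ, hθ2]
  have hYM : 3 * θ + θ / 5 < 6 * θ := by linarith only [hθ]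
  -- ## constants
  obtain ⟨Ca, CE, hCa, hCE, β₁, hpack⟩ := exists_datum_packageG_datVec ρ hρc hinj hρu hθ hδ0 hwin9
  obtain ⟨r₂, C₂, cH, hr₂, -, hC₂, hcH, J, hJc, hJb, hJhalf, hdens⟩ :=
    exists_chartMeasureE_restrict_closedBall_eq_withDensity ρ hρc hinj hρu
  obtain ⟨η₀, hη₀, hwinη⟩ := linkWindow_subset_image_expChart ρ hρc hinj hρu
  obtain ⟨β₂, hrare⟩ := boxKernelG_real_coldGoodSetG_compl_le_trunc ρ hρu hρc hθ hδ0 hYM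
  -- FACTS
  have hfacts := eventually_kernelDatum_boundsG N (dimE ρ) hCa hCE hr₂ hC₂ hη₀ hθ hθ2
  obtain ⟨β₃, hB⟩ := Filter.eventually_atTop.1 hfacts
  refine ⟨CE, max β₁ (max β₂ β₃), fun β hβ ω hω => ?_⟩
  have hb₁ : β₁ ≤ β := (le_max_left _ _).trans hβ
  have hb₂ : β₂ ≤ β := ((le_max_left _ _).trans (le_max_right _ _)).trans hβ
  have hb₃ : β₃ ≤ β := ((le_max_right _ _).trans (le_max_right _ _)).trans hβ
  obtain ⟨hβ1, h8T, hLη, hm4, hmr₂, hmEm, hwin, hP2, hcov, -⟩ := hB β hb₃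
  clear hB hfacts
  have hβ0 : 0 < β := by linarith only [hβ1]
  have hH : 1 ≤ ⌈β ^ θ⌉₊ := by
    have := (one_le_ceil_rpow_and_le (A := θ) hβ1 hθ.le).1
    exact_mod_cast this
  -- ## the datum package at `β`, `ω`
  obtain ⟨g, ϑ, s, hWall, hϑr, hϑsq, -, hforest, -, hE⟩ := hpack β hb₁ ω hω
  have hr0 : 0 ≤ Ca * β ^ (3 * θ + θ / 5 - 1 / 2) := by positivity
  have hϑ2 : ∀ e, ∑ c, ϑ c e ^ 2 ≤ (Ca * β ^ (3 * θ + θ / 5 - 1 / 2)) ^ 2 := fun e => by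
    rw [const_mul_rpow_sq hβ0.le, show 2 * (3 * θ + θ / 5 - 1 / 2) = 6 * θ + 2 * (θ / 5) - 1 by ring]
    exact hϑsq e
  -- ## the chart ball `m = 2L`: density, link window, exterior radius inside
  have hL0 : 0 < (12 * (⌈β ^ θ⌉₊ : ℝ) ^ 2 + 2 * ⌈β ^ θ⌉₊ + 1) *
      (Real.sqrt 2 * Real.sqrt (β ^ (2 * (6 * θ) - 1)) + 8 * (Ca * β ^ (3 * θ + θ / 5 - 1 / 2))) := by
    have : 0 < Real.sqrt (β ^ (2 * (6 * θ) - 1)) := Real.sqrt_pos.2 (Real.rpow_pos_of_pos hβ0 _)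
    positivity
  have hm0 : 0 < 2 * ((12 * (⌈β ^ θ⌉₊ : ℝ) ^ 2 + 2 * ⌈β ^ θ⌉₊ + 1) *
      (Real.sqrt 2 * Real.sqrt (β ^ (2 * (6 * θ) - 1)) + 8 * (Ca * β ^ (3 * θ + θ / 5 - 1 / 2)))) := by positivity
  have hrm : Ca * β ^ (3 * θ + θ / 5 - 1 / 2) ≤ 2 * ((12 * (⌈β ^ θ⌉₊ : ℝ) ^ 2 + 2 * ⌈β ^ θ⌉₊ + 1) *
      (Real.sqrt 2 * Real.sqrt (β ^ (2 * (6 * θ) - 1)) + 8 * (Ca * β ^ (3 * θ + θ / 5 - 1 / 2)))) := by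
    have hH1 : (1 : ℝ) ≤ ⌈β ^ θ⌉₊ := by exact_mod_cast hH
    exact le_chartBall_of_window (by nlinarith only [hH1]) (by positivity) hr0
  have hgpos : ∀ a : EuclideanSpace ℝ (Fin (dimE ρ)), ‖a‖ ≤ 2 * ((12 * (⌈β ^ θ⌉₊ : ℝ) ^ 2 + 2 * ⌈β ^ θ⌉₊ + 1) *
      (Real.sqrt 2 * Real.sqrt (β ^ (2 * (6 * θ) - 1)) + 8 * (Ca * β ^ (3 * θ + θ / 5 - 1 / 2)))) → 0 < J a := fun a ha => by
    linarith only [(hJhalf a (ha.trans hmr₂)).1]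
  have hℓ0 : 0 ≤ 2 * C₂ * (2 * ((12 * (⌈β ^ θ⌉₊ : ℝ) ^ 2 + 2 * ⌈β ^ θ⌉₊ + 1) *
      (Real.sqrt 2 * Real.sqrt (β ^ (2 * (6 * θ) - 1)) + 8 * (Ca * β ^ (3 * θ + θ / 5 - 1 / 2))))) ^ 2 := by positivity
  have hg : ∀ a : EuclideanSpace ℝ (Fin (dimE ρ)), ‖a‖ ≤ 2 * ((12 * (⌈β ^ θ⌉₊ : ℝ) ^ 2 + 2 * ⌈β ^ θ⌉₊ + 1) *
      (Real.sqrt 2 * Real.sqrt (β ^ (2 * (6 * θ) - 1)) + 8 * (Ca * β ^ (3 * θ + θ / 5 - 1 / 2)))) →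
      |Real.log (J a)| ≤ 2 * C₂ * (2 * ((12 * (⌈β ^ θ⌉₊ : ℝ) ^ 2 + 2 * ⌈β ^ θ⌉₊ + 1) *
        (Real.sqrt 2 * Real.sqrt (β ^ (2 * (6 * θ) - 1)) + 8 * (Ca * β ^ (3 * θ + θ / 5 - 1 / 2))))) ^ 2 := fun a ha => by
    refine (abs_log_jacobian_le hJb hJhalf a (ha.trans hmr₂)).trans ?_
    have : ‖a‖ ^ 2 ≤ (2 * ((12 * (⌈β ^ θ⌉₊ : ℝ) ^ 2 + 2 * ⌈β ^ θ⌉₊ + 1) *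
        (Real.sqrt 2 * Real.sqrt (β ^ (2 * (6 * θ) - 1)) + 8 * (Ca * β ^ (3 * θ + θ / 5 - 1 / 2))))) ^ 2 :=
      pow_le_pow_left₀ (norm_nonneg _) ha 2
    nlinarith only [this, hC₂.le]
  have hc0 : ENNReal.ofReal cH ≠ 0 := by rw [ENNReal.ofReal_ne_zero_iff]; exact hcH
  have hdensm := hdens _ hm0 hmr₂
  have hball := fun u hu => hwinη _ hLη u hu
  -- ## YM rarity at `W`
  have hpY := hrare β hb₂ ω hω g
  have hpY1 : Real.exp (-(β ^ (6 * θ))) < 1 := by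
    rw [Real.exp_lt_one_iff]; exact neg_lt_zero.2 (Real.rpow_pos_of_pos hβ0 _)
  have hR0 : 0 ≤ β ^ (6 * θ) / (4 * (Real.sqrt (dimE ρ) + 1)) := by positivity
  have hR' : Real.sqrt (β * (CE * (2 * (⌈β ^ θ⌉₊ : ℝ) + 3) ^ 4 * β ^ (2 * (θ / 5) - 1))) +
      4 * (Real.sqrt β * (Ca * β ^ (3 * θ + θ / 5 - 1 / 2))) ≤
      Real.sqrt β * Real.sqrt (CE * (2 * (⌈β ^ θ⌉₊ : ℝ) + 3) ^ 4 * β ^ (2 * (θ / 5) - 1)) +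
        4 * (Real.sqrt β * (Ca * β ^ (3 * θ + θ / 5 - 1 / 2))) := by
    rw [Real.sqrt_mul hβ0.le]
  -- ## the one-`β` theorem
  have key := kernelCovG_sub_interface_le ρ hρc hinj hρu (ε := 6 * θ) hβ1 hH h8T ω g hWall hr0 hϑr hϑ2 hforest hE hpY hpY1 hrm hm4
    hball hJc.measurable hgpos hℓ0 hg hc0 ENNReal.ofReal_ne_top hdensm hR0 hR' hmEm hwin hP2
  -- ## the interface's datum `ϑ⁰ = ϑ/√2` and its energy clause
  refine ⟨fun c => (1 / Real.sqrt 2) • ϑ c, fun c => (1 / Real.sqrt 2) • s c, ?_, key.trans hcov⟩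
  have h := sum_formM_smul_chartCoords (H := ⌈β ^ θ⌉₊) (1 / Real.sqrt 2) ϑ s
  have hhalf : (1 / Real.sqrt 2) ^ 2 = 1 / 2 := by rw [div_pow, one_pow, Real.sq_sqrt (by norm_num : (0 : ℝ) ≤ 2)]
  have hS0 : 0 ≤ ∑ c, formM (fun e => e ∉ dirFreeEdges ⌈β ^ θ⌉₊) dirCorner (2 * ⌈β ^ θ⌉₊ + 3) (ϑ c) (s c) :=
    Finset.sum_nonneg fun c _ => formM_nonneg _ _
  show ∑ c, formM (fun e => e ∉ dirFreeEdges ⌈β ^ θ⌉₊) dirCorner (2 * ⌈β ^ θ⌉₊ + 3) ((1 / Real.sqrt 2) • ϑ c) ((1 / Real.sqrt 2) • s c) ≤ _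
  rw [h, hhalf]
  linarith only [hE, hS0, hCE]

end Box

/-! ## The registered stub -/

/-- **Registered stub `stub_kernelCovExpansionG` of crux `BulkAllGroups`** (line `dlr-chessboard-G`, skeleton v5), by name and signature: for every
compact simple `G` and every `r : LatticeRep G` there is `θ₂ > 0` (`= 1/200`) with `KernelCovExpansionG r.ρ (θ/20) θ (θ/5)` for all `0 < θ ≤ θ₂` —
uniformly over crude-good data, the deep two-plaquette kernel covariance is its Dirichlet–Gaussian value `(D/2)C_D² + 2β(Σ_c F̄_c(p)F̄_c(q))C_D` up to
`β^{−θ/2}`. -/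
theorem stub_kernelCovExpansionG :
    ∀ (G : Type) [Group G] [TopologicalSpace G] [IsTopologicalGroup G] [CompactSpace G] [MeasurableSpace G] [BorelSpace G],
    IsCompactSimpleLieGroup G → ∀ r : LatticeRep G, ∃ θ₂ : ℝ, 0 < θ₂ ∧ ∀ θ : ℝ, 0 < θ → θ ≤ θ₂ →
      KernelCovExpansionG r.ρ (θ / 20) θ (θ / 5) := by
  intro G _ _ _ _ _ _ hG r
  haveI : SecondCountableTopology G := r.secondCountableTopology
  exact ⟨1 / 200, by norm_num, fun θ hθ hθ2 => kernelCovExpansionG_of_le r.ρ r.continuous r.injective r.mem_unitary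
    (Summit.QuantumFields.YangMills.Cruxes.NT.LinkEquipartition.dimE_pos_of_isCompactSimpleLieGroup G r hG) hθ hθ2⟩

end Summit.QuantumFields.YangMills.Theorems.ColdBoxAllGroups

end
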